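import Summits.CriticalPhenomena.PercolationContinuityZ3.Theorems.PercNearOneGluingNoHeavyPcintNawRandMem
import HarnessLib

/-!
# PCINT lane: the parity law of the memory-`τ` dangerous-set automaton (odd memory adds nothing)

Cell `prim-pcint` (PAPER-2 track (iii)), seat `prim-pcint-2` (gen 11); support file (`--supports stmt-CriticalPhenomena-4575`).
Does NOT build on p205010.  Lane memo `run/shared/lean/prim/pcint/STRUCTURE.md` (C2): every landscape table of the lane stops at even
memory because an odd memory step was observed to add no state class and no threshold gain (gen 11: d = 4, 5, τ = 8 vs 9).  The
mechanism is the bipartite parity of `ℤ^d`: along the automaton, a remembered site of age `a` has `ℓ¹`-norm `≡ a (mod 2)`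
(the PARITY INVARIANT, preserved by `mstep` — `parityOK_of_mstep`), and on such states the reach condition `ℓ¹ ≤ τ − age` has even slack,
so the memory-`(2m+1)` step IS the memory-`2m` step: **`mstep_odd_eq`**.  Hence (induction along a word from `∅`, `parityOK_empty` +
`parityOK_of_mstep`) both automata accept the same words with the same dangerous sets; every bookkeeping rule whose `τ`-dependence is through parity-even quantities (all the lane's rules with even chain
parameter) has equal thresholds at `τ = 2m` and `2m + 1`.
-/

namespace Summit.CriticalPhenomena.PercolationContinuityZ3.Theorems.Pcint

open Finset Literature.Probability.Percolation Literature.Probability.LatticeModels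

variable {d : ℕ}

/-! ### `ℓ¹` parity flips under a unit step -/

/-- The parity of `|n|` is the parity of `n`. [folklore] -/
theorem natAbs_emod_two (n : ℤ) : ((n.natAbs : ℕ) : ℤ) % 2 = n % 2 := by
  rw [Int.natCast_natAbs]
  rcases abs_choice n with h | h
  · rw [h]
  · rw [h]; omega

/-- `|n - s| + |n|` is odd for a unit `s`. [folklore] -/
theorem natAbs_sub_unit_add_odd (n s : ℤ) (hs : s = 1 ∨ s = -1) : ((n - s).natAbs + n.natAbs) % 2 = 1 := by
  have h1 := natAbs_emod_two (n - s)
  have h2 := natAbs_emod_two n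
  rcases hs with rfl | rfl <;> omega

/-- **A unit step flips the parity of the `ℓ¹` norm**: `ℓ¹(x - e_a) + ℓ¹(x)` is odd. [folklore] -/
theorem l1_sub_stepVec_add_odd (x : Site d) (a : Fin d × Bool) : (l1 (x - stepVec a) + l1 x) % 2 = 1 := by
  classical
  unfold l1
  rw [← Finset.sum_add_distrib, ← Finset.add_sum_erase _ _ (Finset.mem_univ a.1)]
  have hrest : ∀ i ∈ Finset.univ.erase a.1, ((x - stepVec a) i).natAbs + (x i).natAbs = 2 * (x i).natAbs := by
    intro i hi
    rw [Pi.sub_apply, stepVec_apply_of_ne a (Finset.ne_of_mem_erase hi), sub_zero, two_mul]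
  rw [Finset.sum_congr rfl hrest, ← Finset.mul_sum, Pi.sub_apply, stepVec_apply_fst]
  have h := natAbs_sub_unit_add_odd (x a.1) (if a.2 then 1 else -1) (by cases a.2 <;> simp)
  omega

/-! ### The parity invariant -/

/-- The empty state satisfies the invariant. [folklore] -/
theorem parityOK_empty : ∀ q ∈ (∅ : MState d), l1 q.1 % 2 = q.2 % 2 := fun q hq => absurd hq (Finset.notMem_empty q)

/-- **The invariant is preserved by the memory-`τ` step.** [folklore] -/
theorem parityOK_of_mstep {τ : ℕ} {S T : MState d} (hS : ∀ q ∈ S, l1 q.1 % 2 = q.2 % 2) {a : Fin d × Bool}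
    (h : mstep τ S a = some T) : ∀ q ∈ T, l1 q.1 % 2 = q.2 % 2 := by
  classical
  unfold mstep at h
  split_ifs at h with hrej
  simp only [Option.some.injEq] at h
  subst h
  intro q hq
  rw [Finset.mem_insert, Finset.mem_filter, Finset.mem_image] at hq
  rcases hq with rfl | ⟨⟨q', hq', rfl⟩, -⟩
  · simp [l1_neg, l1_stepVec]
  · simp only
    have h1 := l1_sub_stepVec_add_odd q'.1 a
    have h2 := hS q' hq'
    omega

/-! ### Odd memory adds nothing -/

/-- **The parity law.**  On a state satisfying the parity invariant, the memory-`(2m+1)` step equals the memory-`2m` step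
(`m ≥ 1`). [folklore] -/
theorem mstep_odd_eq {m : ℕ} (hm : 1 ≤ m) {S : MState d} (hS : ∀ q ∈ S, l1 q.1 % 2 = q.2 % 2) (a : Fin d × Bool) :
    mstep (2 * m + 1) S a = mstep (2 * m) S a := by
  classical
  unfold mstep
  by_cases hrej : ∃ q ∈ S, q.1 = stepVec a
  · rw [if_pos hrej, if_pos hrej]
  · rw [if_neg hrej, if_neg hrej]
    congr 1
    congr 1
    refine Finset.filter_congr fun q hq => ?_
    rw [Finset.mem_image] at hq
    obtain ⟨q', hq', rfl⟩ := hq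
    simp only
    -- the shifted site is not the origin (else the step was rejected), so its norm is positive
    have hne : q'.1 - stepVec a ≠ 0 := fun h0 => hrej ⟨q', hq', sub_eq_zero.1 h0⟩
    have hpos : 1 ≤ l1 (q'.1 - stepVec a) := by
      refine Nat.one_le_iff_ne_zero.2 fun h0 => hne ?_
      funext i
      have hle : ((q'.1 - stepVec a) i).natAbs ≤ l1 (q'.1 - stepVec a) :=
        Finset.single_le_sum (f := fun j => ((q'.1 - stepVec a) j).natAbs) (fun _ _ => Nat.zero_le _) (Finset.mem_univ i)
      exact Int.natAbs_eq_zero.1 (by omega)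
    -- parity: ℓ¹(shifted) ≡ age + 1
    have hpar : l1 (q'.1 - stepVec a) % 2 = (q'.2 + 1) % 2 := by
      have h1 := l1_sub_stepVec_add_odd q'.1 a
      have h2 := hS q' hq'
      omega
    constructor
    · rintro ⟨hage, hl1⟩
      refine ⟨?_, ?_⟩ <;> omega
    · rintro ⟨hage, hl1⟩
      refine ⟨?_, ?_⟩ <;> omega

end Summit.CriticalPhenomena.PercolationContinuityZ3.Theorems.Pcint
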